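import Summits.Ventures.PercRepro.Night2LocalD3Zero
import Summits.Ventures.PercRepro.Night2LocalSimpleCount

/-!
# PercRepro — the regime `|E ∖ G| = 3` at `q = 4` on COLOOP-FREE flats: closure tools and the six-element structure (night-2, gen 12)

Sequel of `Night2LocalD3Zero.lean`, first half of the sets with at most one coloop:

* closure tools for an independent set `I`: `cl X ∩ cl Y ⊆ cl (X ∩ Y)` for `X, Y ⊆ I` (`mem_clF_inter_of_indep`),
  hence a point of `cl I` in `cl (I ∖ b)` for every `b ∈ J` lies in `cl (I ∖ J)` (`mem_clF_sdiff_of_forall_mem_clF_erase`),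
  and a point outside `I` cannot lie in `cl (I ∖ b)` for all but one `b` in a loopless simple matroid
  (`not_mem_clF_all_but_one`);
* the structure forced by a loss without coloops of `M|G` at `d = 3`: a member carrying layer-2 weight at `S`
  has a nonzero loss at a covering set (`exists_loss_ne_zero_of_mem_ex2`), which then has `L1 > 1`
  (`one_lt_L1_of_loss_ne_zero`), hence at least five coloops (`five_le_card_coloops_of_one_lt_L1`), hence is
  an independent five-set (`indep_of_five_le_card_coloops`): `|S| = 6` (`card_eq_six_of_mem_ex2`); deleting a
  non-coloop of such an `S` leaves an independent set (`indep_erase_of_not_coloop`); the coloops of `S` lie in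
  every member carrying layer-2 weight (`mem_of_mem_ex2_of_mem_coloops`); `G ∖ S ≠ ∅` (`exists_mem_sdiff_of_mem_ex2`).

The fat-pair count and the column bound are in `Night2LocalD3ZeroFat.lean`.  Paper: `proofs/NIGHT-2-dq3.md` §1–§3.
-/

open scoped Matroid

namespace PercRepro.Shadow

open Finset PerFlat ThmH

variable {α : Type*} [DecidableEq α] {M : Matroid α} [M.Finite]

section Closure

omit [DecidableEq α] in
/-- The closure of a finset lies in the ground set. -/
theorem mem_gr_of_mem_clF {X : Finset α} {e : α} (he : e ∈ clF M X) : e ∈ gr M := by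
  have h1 : e ∈ M.closure (X : Set α) := by rw [← coe_clF]; exact_mod_cast he
  have h2 : e ∈ M.E := M.closure_subset_ground _ h1
  rw [← coe_gr] at h2
  exact_mod_cast h2

omit [DecidableEq α] in
/-- An independent finset has rank equal to its cardinality. -/
theorem rkN_eq_card_of_indep {X : Finset α} (hX : M.Indep (X : Set α)) : rkN M X = X.card := by
  unfold rkN
  rw [hX.eRk_eq_encard, Set.encard_coe_eq_coe_finsetCard]
  exact ENat.toNat_coe _

omit [DecidableEq α] in
/-- A finset whose rank equals its cardinality is independent. -/
theorem indep_of_rkN_eq_card {X : Finset α} (h : rkN M X = X.card) : M.Indep (X : Set α) := by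
  rw [Matroid.indep_iff_eRk_eq_encard_of_finite (Finset.finite_toSet X), eRk_eq_rkN, h,
    Set.encard_coe_eq_coe_finsetCard]

omit [DecidableEq α] in
/-- An independent finset lies in the ground set. -/
theorem subset_gr_of_indep {I : Finset α} (hI : M.Indep (I : Set α)) : I ⊆ gr M := by
  intro x hx
  have h := hI.subset_ground (Finset.mem_coe.2 hx)
  rw [← coe_gr] at h
  exact_mod_cast h

/-- **Closures of subsets of an independent set intersect in the closure of the intersection**: for `X, Y ⊆ I`
with `I` independent, `cl X ∩ cl Y ⊆ cl (X ∩ Y)`. -/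
theorem mem_clF_inter_of_indep {I : Finset α} (hI : M.Indep (I : Set α)) {X Y : Finset α} (hX : X ⊆ I)
    (hY : Y ⊆ I) {e : α} (heX : e ∈ clF M X) (heY : e ∈ clF M Y) : e ∈ clF M (X ∩ Y) := by
  have hIg : I ⊆ gr M := subset_gr_of_indep hI
  have hXg : X ⊆ gr M := hX.trans hIg
  have hYg : Y ⊆ gr M := hY.trans hIg
  have hXi : M.Indep (X : Set α) := hI.subset (by exact_mod_cast hX)
  have hYi : M.Indep (Y : Set α) := hI.subset (by exact_mod_cast hY)
  have hXYi : M.Indep ((X ∪ Y : Finset α) : Set α) :=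
    hI.subset (by exact_mod_cast Finset.union_subset hX hY)
  have hXYi' : M.Indep ((X ∩ Y : Finset α) : Set α) :=
    hI.subset (by exact_mod_cast (Finset.inter_subset_left).trans hX)
  have r1 : rkN M (clF M X) = X.card := by rw [rkN_clF, rkN_eq_card_of_indep hXi]
  have r2 : rkN M (clF M Y) = Y.card := by rw [rkN_clF, rkN_eq_card_of_indep hYi]
  have r3 : (X ∪ Y).card ≤ rkN M (clF M X ∪ clF M Y) := by
    rw [← rkN_eq_card_of_indep hXYi]
    apply rkN_mono
    exact Finset.union_subset_union (subset_clF_of_subset_gr hXg) (subset_clF_of_subset_gr hYg)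
  have hsub := rkN_inter_add_rkN_union_le (M := M) (clF M X) (clF M Y)
  have hcard := Finset.card_union_add_card_inter X Y
  have r4 : rkN M (clF M X ∩ clF M Y) ≤ (X ∩ Y).card := by omega
  have hsubXY : insert e (X ∩ Y) ⊆ clF M X ∩ clF M Y := by
    apply Finset.insert_subset (Finset.mem_inter.2 ⟨heX, heY⟩)
    exact Finset.inter_subset_inter (subset_clF_of_subset_gr hXg) (subset_clF_of_subset_gr hYg)
  have r5 : rkN M (insert e (X ∩ Y)) ≤ (X ∩ Y).card := (rkN_mono hsubXY).trans r4
  have r6 : rkN M (X ∩ Y) = (X ∩ Y).card := rkN_eq_card_of_indep hXYi'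
  have r7 : rkN M (X ∩ Y) = rkN M (insert e (X ∩ Y)) := by
    have := rkN_mono (M := M) (Finset.subset_insert e (X ∩ Y))
    omega
  have hgr : insert e (X ∩ Y) ⊆ gr M :=
    Finset.insert_subset (mem_gr_of_mem_clF heX) ((Finset.inter_subset_left).trans hXg)
  have h := subset_closure_of_rkN_eq hgr (Finset.subset_insert e (X ∩ Y)) r7
  have h2 : e ∈ M.closure ((X ∩ Y : Finset α) : Set α) := h (by exact_mod_cast Finset.mem_insert_self e (X ∩ Y))
  rw [← coe_clF] at h2
  exact_mod_cast h2

/-- **Iterated**: for an independent `I` and `J ⊆ I`, a point of `cl I` lying in `cl (I ∖ b)` for every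
`b ∈ J` lies in `cl (I ∖ J)`. -/
theorem mem_clF_sdiff_of_forall_mem_clF_erase {I : Finset α} (hI : M.Indep (I : Set α)) {e : α}
    (heI : e ∈ clF M I) (J : Finset α) (hJ : J ⊆ I) (h : ∀ b ∈ J, e ∈ clF M (I.erase b)) :
    e ∈ clF M (I \ J) := by
  induction J using Finset.induction_on with
  | empty => rw [Finset.sdiff_empty]; exact heI
  | @insert b J hbJ ih =>
    have hJ' : J ⊆ I := (Finset.subset_insert b J).trans hJ
    have h1 := ih hJ' (fun c hc => h c (Finset.mem_insert_of_mem hc))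
    have h2 := h b (Finset.mem_insert_self b J)
    have h3 := mem_clF_inter_of_indep hI Finset.sdiff_subset (Finset.erase_subset b I) h1 h2
    have heq : (I \ J) ∩ I.erase b = I \ insert b J := by
      ext x
      simp only [Finset.mem_inter, Finset.mem_sdiff, Finset.mem_erase, Finset.mem_insert]
      tauto
    rwa [heq] at h3

/-- **A point in the closures of all but one element of an independent set is parallel to that element**: in a
loopless simple matroid, if `I` is independent, `J ⊆ I` with `|I ∖ J| ≤ 1`, and `e ∉ I` lies in `cl (I ∖ b)` for
every `b ∈ J` (and in `cl I`), then `False`. -/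
theorem not_mem_clF_all_but_one (hs : ∀ e ∈ gr M, ∀ f ∈ gr M, e ≠ f → rkN M {e, f} = 2)
    (hl : ∀ e ∈ gr M, M.Indep {e}) {I : Finset α} (hI : M.Indep (I : Set α)) {J : Finset α} (hJ : J ⊆ I)
    (hJc : (I \ J).card ≤ 1) {e : α} (heI : e ∈ clF M I) (heJ : ∀ b ∈ J, e ∈ clF M (I.erase b)) (heI' : e ∉ I) :
    False := by
  have hIg : I ⊆ gr M := subset_gr_of_indep hI
  have hmem := mem_clF_sdiff_of_forall_mem_clF_erase hI heI J hJ heJ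
  have hZg : I \ J ⊆ gr M := Finset.sdiff_subset.trans hIg
  have heg : e ∈ gr M := mem_gr_of_mem_clF heI
  have hins : rkN M (insert e (I \ J)) ≤ rkN M (I \ J) := rkN_insert_le_of_mem_clF hZg hmem
  have hZ : rkN M (I \ J) ≤ (I \ J).card := rkN_le_card _
  rcases Finset.eq_empty_or_nonempty (I \ J) with hemp | ⟨s, hsZ⟩
  · rw [hemp] at hins hZ
    simp only [Finset.insert_empty] at hins
    have h1 : rkN M ({e} : Finset α) = 1 := by
      rw [rkN_eq_card_of_indep (by push_cast; exact hl e heg), Finset.card_singleton]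
    rw [h1] at hins
    rw [Finset.card_empty] at hZ
    omega
  · have hsI : s ∈ I := (Finset.mem_sdiff.1 hsZ).1
    have hne : e ≠ s := by rintro rfl; exact heI' hsI
    have hpair : ({e, s} : Finset α) ⊆ insert e (I \ J) := by
      intro x hx
      rw [Finset.mem_insert, Finset.mem_singleton] at hx
      rcases hx with rfl | rfl
      · exact Finset.mem_insert_self _ _
      · exact Finset.mem_insert_of_mem hsZ
    have h2 : rkN M ({e, s} : Finset α) = 2 := hs e heg s (hIg hsI) hne
    have h3 := rkN_mono (M := M) hpair
    omega

end Closure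

section Structure

variable {G S : Finset α}

open scoped Classical in
/-- A member carrying layer-2 weight at `S` has a nonzero loss at one of its two covering sets inside `S`. -/
theorem exists_loss_ne_zero_of_mem_ex2 {q : ℕ} {B : Finset α} (hB : B ∈ ex2 M q G S) :
    ∃ z ∈ S \ B, loss M q G B z ≠ 0 := by
  obtain ⟨-, hB0, hBS, hsub, hcard⟩ := mem_ex2_unpack hB
  unfold ex2 at hB
  rw [Finset.mem_filter] at hB
  have hw := hB.2
  unfold w2 at hw
  rw [if_pos ⟨hB0, hBS, hsub, hcard⟩] at hw
  by_contra hall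
  push Not at hall
  apply hw
  rw [Finset.sum_eq_zero hall, zero_div]

open scoped Classical in
/-- Without coloops of `M|G`, a nonzero loss at `insert z B` means `L1 (insert z B) > 1`. -/
theorem one_lt_L1_of_loss_ne_zero {q : ℕ} (hk : kColoops M G = 0) {B : Finset α} {z : α}
    (h : loss M q G B z ≠ 0) : 1 < L1 M q G (insert z B) := by
  by_contra hle
  push Not at hle
  apply h
  unfold loss fS
  rw [capS_eq_one_of_kColoops_eq_zero hk, if_pos hle, sub_self, mul_zero]

open scoped Classical in
/-- At `d = 3`, `q = 4`: `L1 S > 1` forces at least five coloops of `S`. -/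
theorem five_le_card_coloops_of_one_lt_L1 (hG : G ∈ flatsQ M (4 + 1)) (hd : (gr M \ G).card = 3)
    (S : Finset α) (h : 1 < L1 M 4 G S) : 5 ≤ (coloops M S).card := by
  by_contra hlt
  push Not at hlt
  have hL := L1_le_coloops_mul hG hd (by norm_num) S
  rw [phiQ_four_div_five] at hL
  have h4 : ((coloops M S).card : ℚ) ≤ 4 := by exact_mod_cast (by omega : (coloops M S).card ≤ 4)
  have h5 : ((coloops M S).card : ℚ) * (6 / 25) ≤ 4 * (6 / 25) :=
    mul_le_mul_of_nonneg_right h4 (by norm_num)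
  linarith

open scoped Classical in
/-- A shadow set with at least five coloops is independent with five elements (loopless `M`): its
non-coloops have rank `0`. -/
theorem indep_of_five_le_card_coloops (hl : ∀ e ∈ gr M, M.Indep {e}) (hG : G ∈ flatsQ M (4 + 1))
    (hS : S ∈ shadowAt M (4 + 2) 4 (Uq M (4 + 2) 4) G) (h5 : 5 ≤ (coloops M S).card) :
    M.Indep (S : Set α) ∧ S.card = 5 := by
  have hSG : S ⊆ G := subset_of_mem_shadowAt hS
  have hSg : S ⊆ gr M := hSG.trans (mem_flatsQ.1 hG).1
  have hr : rkN M S = 4 + 1 := rkN_eq_of_mem_shadowAt hS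
  have hadd := rkN_nonColoops_add (M := M) (S := S) hSg
  have hzero : rkN M (nonColoops M S) = 0 := by omega
  have hnl : ∀ e ∈ gr M, M.IsNonloop e := fun e he => Matroid.indep_singleton.1 (hl e he)
  have hnsub : nonColoops M S ⊆ gr M := by
    unfold nonColoops; exact Finset.sdiff_subset.trans hSg
  have hempty : nonColoops M S = ∅ := eq_empty_of_rkN_eq_zero hnl hnsub hzero
  have hsub : S ⊆ coloops M S := by
    intro x hx
    by_contra hxc
    have hmem : x ∈ nonColoops M S := by unfold nonColoops; exact Finset.mem_sdiff.2 ⟨hx, hxc⟩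
    rw [hempty] at hmem
    exact Finset.notMem_empty x hmem
  have heq : coloops M S = S := Finset.Subset.antisymm (coloops_subset_self S) hsub
  have hind : M.Indep (S : Set α) := by rw [← heq]; exact indep_coloops hSg
  refine ⟨hind, ?_⟩
  have := rkN_eq_card_of_indep hind
  omega

open scoped Classical in
/-- Without coloops of `M|G` at `d = 3`: a shadow set carrying layer-2 weight has exactly six elements (the
covering set of a loss is independent with five elements). -/
theorem card_eq_six_of_mem_ex2 (hl : ∀ e ∈ gr M, M.Indep {e}) (hG : G ∈ flatsQ M (4 + 1))
    (hd : (gr M \ G).card = 3) (hk : kColoops M G = 0) {B : Finset α} (hB : B ∈ ex2 M 4 G S) :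
    S.card = 6 := by
  obtain ⟨z, hz, hloss⟩ := exists_loss_ne_zero_of_mem_ex2 hB
  obtain ⟨hBm, -, hBS, hsub, hcard⟩ := mem_ex2_unpack hB
  have hL := one_lt_L1_of_loss_ne_zero hk hloss
  have h5 := five_le_card_coloops_of_one_lt_L1 hG hd _ hL
  have hS' : insert z B ∈ shadowAt M (4 + 2) 4 (Uq M (4 + 2) 4) G :=
    insert_mem_shadowAt (Finset.Subset.refl _) hG hBm (hsub hz)
  obtain ⟨-, hc5⟩ := indep_of_five_le_card_coloops hl hG hS' h5
  have hzB : z ∉ B := (Finset.mem_sdiff.1 hz).2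
  rw [Finset.card_insert_of_notMem hzB] at hc5
  have := Finset.card_sdiff_add_card_eq_card hBS
  omega

open scoped Classical in
/-- In a six-element shadow set, deleting a non-coloop leaves an independent set. -/
theorem indep_erase_of_not_coloop (hG : G ∈ flatsQ M (4 + 1))
    (hS : S ∈ shadowAt M (4 + 2) 4 (Uq M (4 + 2) 4) G) (hS6 : S.card = 6) {t : α} (ht : t ∈ S)
    (htc : t ∉ coloops M S) : M.Indep ((S.erase t : Finset α) : Set α) := by
  have hSg : S ⊆ gr M := (subset_of_mem_shadowAt hS).trans (mem_flatsQ.1 hG).1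
  have hr : rkN M S = 4 + 1 := rkN_eq_of_mem_shadowAt hS
  have hcl : t ∈ clF M (S.erase t) := by
    by_contra h
    exact htc (mem_coloops.2 ⟨ht, h⟩)
  have h1 : rkN M (insert t (S.erase t)) ≤ rkN M (S.erase t) :=
    rkN_insert_le_of_mem_clF ((Finset.erase_subset t S).trans hSg) hcl
  rw [Finset.insert_erase ht] at h1
  have h2 : rkN M (S.erase t) ≤ rkN M S := rkN_mono (Finset.erase_subset t S)
  apply indep_of_rkN_eq_card
  rw [Finset.card_erase_of_mem ht, hS6]
  omega

/-- The rank of a set drops by one when a coloop is deleted. -/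
theorem rkN_erase_of_mem_coloops (hSg : S ⊆ gr M) {t : α} (ht : t ∈ coloops M S) :
    rkN M S = rkN M (S.erase t) + 1 := by
  have htS : t ∈ S := (mem_coloops.1 ht).1
  have htcl : t ∉ clF M (S.erase t) := (mem_coloops.1 ht).2
  have htE : t ∈ M.E \ M.closure ((S.erase t : Finset α) : Set α) := by
    refine ⟨by rw [← coe_gr]; exact_mod_cast hSg htS, ?_⟩
    intro h
    apply htcl
    rw [← Finset.mem_coe, coe_clF]
    exact h
  have h := Matroid.eRk_insert_eq_add_one htE
  rw [← Finset.coe_insert, Finset.insert_erase htS, eRk_eq_rkN, eRk_eq_rkN] at h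
  exact_mod_cast h

open scoped Classical in
/-- A coloop of `S` lies in every member carrying layer-2 weight at `S`: the two missing elements of such a
member are outside its closure, so deleting one of them keeps the rank `5`. -/
theorem mem_of_mem_ex2_of_mem_coloops (hG : G ∈ flatsQ M (4 + 1))
    (hS : S ∈ shadowAt M (4 + 2) 4 (Uq M (4 + 2) 4) G) {B : Finset α} (hB : B ∈ ex2 M 4 G S) {t : α}
    (ht : t ∈ coloops M S) : t ∈ B := by
  by_contra htB
  obtain ⟨hBm, -, hBS, hsub, hcard⟩ := mem_ex2_unpack hB
  have hSg : S ⊆ gr M := (subset_of_mem_shadowAt hS).trans (mem_flatsQ.1 hG).1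
  have htS : t ∈ S := (mem_coloops.1 ht).1
  have htSB : t ∈ S \ B := Finset.mem_sdiff.2 ⟨htS, htB⟩
  obtain ⟨z', hz'SB, hz't⟩ : ∃ z' ∈ S \ B, z' ≠ t := by
    by_contra hno
    push Not at hno
    have hsub1 : S \ B ⊆ {t} := fun x hx => Finset.mem_singleton.2 (hno x hx)
    have := Finset.card_le_card hsub1
    rw [Finset.card_singleton] at this
    omega
  have hz'cl : z' ∈ G \ clF M B := hsub hz'SB
  have hsub2 : insert z' B ⊆ S.erase t := by
    intro x hx
    rw [Finset.mem_insert] at hx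
    rw [Finset.mem_erase]
    rcases hx with rfl | hxB
    · exact ⟨hz't, (Finset.mem_sdiff.1 hz'SB).1⟩
    · refine ⟨?_, hBS hxB⟩
      rintro rfl
      exact htB hxB
  have hBU : B ∈ Uq M (4 + 2) 4 := (mem_membersIn.1 hBm).1
  have hrB : rkN M B = 4 := by
    have h := (mem_Uq.1 hBU).2.1
    rw [eRk_eq_rkN] at h
    exact_mod_cast h
  have hz'E : z' ∈ M.E \ M.closure (B : Set α) := by
    refine ⟨?_, ?_⟩
    · rw [← coe_gr]; exact_mod_cast (mem_flatsQ.1 hG).1 (Finset.mem_sdiff.1 hz'cl).1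
    · intro h
      apply (Finset.mem_sdiff.1 hz'cl).2
      rw [← Finset.mem_coe, coe_clF]
      exact h
  have h5 : rkN M (insert z' B) = 5 := by
    have h := Matroid.eRk_insert_eq_add_one hz'E
    rw [← Finset.coe_insert, eRk_eq_rkN, eRk_eq_rkN, hrB] at h
    exact_mod_cast h
  have hr : rkN M S = 4 + 1 := rkN_eq_of_mem_shadowAt hS
  have hdrop := rkN_erase_of_mem_coloops hSg ht
  have hmono := rkN_mono (M := M) hsub2
  omega

open scoped Classical in
/-- A member carrying layer-2 weight at `S` leaves a point of `G` outside `S`. -/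
theorem exists_mem_sdiff_of_mem_ex2 (hG : G ∈ flatsQ M (4 + 1)) (hd : (gr M \ G).card = 3)
    (hS : S ∈ shadowAt M (4 + 2) 4 (Uq M (4 + 2) 4) G) {B : Finset α} (hB : B ∈ ex2 M 4 G S) :
    ∃ p ∈ G, p ∉ S := by
  obtain ⟨hBm, -, hBS, -, hcard⟩ := mem_ex2_unpack hB
  have hSG : S ⊆ G := subset_of_mem_shadowAt hS
  have hGg : G ⊆ gr M := (mem_flatsQ.1 hG).1
  have hBU : B ∈ Uq M (4 + 2) 4 := (mem_membersIn.1 hBm).1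
  have hr6 : rkN M (gr M \ B) = 6 := by
    have h := (mem_Uq.1 hBU).2.2
    rw [eRk_eq_rkN] at h
    exact_mod_cast h
  have hc6 : 6 ≤ (gr M \ B).card := hr6 ▸ rkN_le_card _
  have hBG : B ⊆ G := hBS.trans hSG
  have hGg' : (gr M \ G).card + G.card = (gr M).card := Finset.card_sdiff_add_card_eq_card hGg
  have hBG' : (G \ B).card + B.card = G.card := Finset.card_sdiff_add_card_eq_card hBG
  have hBgr : (gr M \ B).card + B.card = (gr M).card := Finset.card_sdiff_add_card_eq_card (hBG.trans hGg)
  have hSG' : (G \ S).card + S.card = G.card := Finset.card_sdiff_add_card_eq_card hSG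
  have hBS' : (S \ B).card + B.card = S.card := Finset.card_sdiff_add_card_eq_card hBS
  have hpos : 0 < (G \ S).card := by omega
  obtain ⟨p, hp⟩ := Finset.card_pos.1 hpos
  exact ⟨p, (Finset.mem_sdiff.1 hp).1, (Finset.mem_sdiff.1 hp).2⟩

end Structure

end PercRepro.Shadow
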